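import Summits.QuantumFields.YangMills.Theorems.SteinGapBootstrapFreeProbeLawGBlockGreenCurl
import Literature.Probability.LatticeModels.LatticeGreenPoisson
import HarnessLib

/-!
# Block Green one-form of a plaquette, II: Hodge identity and the reproducing identity (support file of stub `stub_blockGreen`)

Route `SteinGapBootstrap` of `YangMills`, crux U = `Theses.SteinGapBootstrap.FreeProbeLawG`
(stmt-QuantumFields-23756), line `birth` (RESHAPE 2, lead `ym-line-sgb-k1`), registered stub
`stub_blockGreen`. Sequel of `SteinGapBootstrapFreeProbeLawGBlockGreenCurl`; for the Green one-form
`ω_p(e) = ∑ₐ σₐ Γ(∂ₐ p, e) = (Γ d^* δ_p)(e)` of a plaquette `p`: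

* `hodge_pairing` — the flat-lattice Hodge (Weitzenböck) identity on `1`-forms in paired form,
  `⟨d δ_e, d A⟩ = (d^* d A)(e) = (-Δ A_k)(y) - [(div A)(y + e_k) - (div A)(y)]`, `div A (x) = ∑ⱼ (A(x - eⱼ, j) - A(x, j))`
  (`d^*d + d d^* = -Δ` componentwise on the cubic lattice; every `d`);
* `div_greenForm` — `div ω_p = 0` (`d^* Γ d^* δ_p = Γ d^* d^* δ_p = 0`, a four-term telescoping);
* `neg_laplacian_greenForm` — `-Δ (ω_p)_k (y) = (d^* δ_p)(y, k)` (`d ≥ 3`; `-Δ Γ = id`, the tree's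
  `latticeLaplacianZd_half_latticeGreen`);
* `sum_plaquetteCurl_single_mul_curvatureTwoPoint` — THE REPRODUCING IDENTITY
  `∑_q (d δ_e)(q) Π(p, q) = (d δ_e)(p)` and, by linearity, `sum_plaquetteCurl_mul_curvatureTwoPoint`:
  `∑_q (dA)(q) Π(p, q) = (dA)(p)` for every FINITELY SUPPORTED `1`-form `A` (the sum over any finite set of
  plaquettes containing those that touch the support of `A`). This is the statement that `Π = dΓd^*` is the
  (`ℓ²`-orthogonal) projection onto exact `2`-forms, tested against compactly supported exact forms; it is what
  makes `‖dω‖² = Π(p,p) +` (boundary layer) in the stub, with no infinite sums anywhere.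

All statements are written with explicit lambdas (no new definitions). HONEST LABEL: route SteinGapBootstrap
closes the RECORD rung R2ξ-G (`WeakCouplingRates.XiPow`) conditionally on U; nothing here bears on the
Yang–Mills mass gap itself.
-/

open Finset
open Literature.MathematicalPhysics.QuantumFieldTheory Literature.MathematicalPhysics.QuantumLattice
  Literature.Probability.LatticeModels

namespace Summit.QuantumFields.YangMills.Theorems.SteinGapBootstrap.BlockGreen

variable {d : ℕ}

/-! ### The Hodge identity `d^*d + dd^* = -Δ` on `1`-forms, paired form -/

/-- **Hodge (Weitzenböck) identity on the flat lattice, paired with an edge indicator.** For every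
`1`-form `A`, edge `(y, k)` and finite `T` containing the plaquettes through `(y, k)`:
`∑_{q ∈ T} (dδ_{(y,k)})(q) (dA)(q) = -(Δ A(·, k))(y) - [(div A)(y + e_k) - (div A)(y)]`,
where `div A (x) = ∑ⱼ (A(x - eⱼ, j) - A(x, j))` and `Δ = latticeLaplacianZd` acts on the `k`-component.
(`d^*dA = -ΔA - dd^*A`; the diagonal `j = k` terms of the two pieces cancel, so the sums run over all `j`.) -/
theorem hodge_pairing (A : ZdEdge d → ℝ) (y : Site d) (k : Fin d)
    (T : Finset (ZdPlaquette d)) (hT : ∀ q : ZdPlaquette d, (y, k) ∈ plaquetteEdges q → q ∈ T) :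
    ∑ q ∈ T, plaquetteCurl (fun e => if e = (y, k) then (1 : ℝ) else 0) q * plaquetteCurl A q =
      -latticeLaplacianZd (fun x => A (x, k)) y
        - ((fun x => ∑ j : Fin d, (A (x - Pi.single j 1, j) - A (x, j))) (y + Pi.single k 1)
          - (fun x => ∑ j : Fin d, (A (x - Pi.single j 1, j) - A (x, j))) y) := by
  rw [sum_plaquetteCurl_single_mul (plaquetteCurl A) y k T hT]
  have key : ∀ j : Fin d,
      (((if h : k < j then plaquetteCurl A (y, ⟨(k, j), h⟩) else 0)
          + (if h : j < k then plaquetteCurl A (y - Pi.single j 1, ⟨(j, k), h⟩) else 0))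
          - ((if h : k < j then plaquetteCurl A (y - Pi.single j 1, ⟨(k, j), h⟩) else 0)
          + (if h : j < k then plaquetteCurl A (y, ⟨(j, k), h⟩) else 0))) =
        (2 * A (y, k) - A (y + Pi.single j 1, k) - A (y - Pi.single j 1, k))
          + ((A (y + Pi.single k 1, j) - A (y, j))
            - (A (y + Pi.single k 1 - Pi.single j 1, j) - A (y - Pi.single j 1, j))) := by
    intro j
    have e1 : y - Pi.single j 1 + Pi.single j 1 = y := sub_add_cancel y _
    have e2 : y - Pi.single j 1 + Pi.single k 1 = y + Pi.single k 1 - Pi.single j 1 :=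
      sub_add_eq_add_sub y _ _
    rcases lt_trichotomy k j with h | h | h
    · rw [dif_pos h, dif_neg (not_lt.2 h.le), dif_pos h, dif_neg (not_lt.2 h.le)]
      simp only [plaquetteCurl_eq, e1, e2]
      ring
    · subst h
      rw [dif_neg (lt_irrefl _), dif_neg (lt_irrefl _)]
      simp only [add_sub_cancel_right]
      ring
    · rw [dif_neg (not_lt.2 h.le), dif_pos h, dif_neg (not_lt.2 h.le), dif_pos h]
      simp only [plaquetteCurl_eq, e1, e2]
      ring
  simp_rw [key]
  rw [Finset.sum_add_distrib, latticeLaplacianZd_def]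
  simp only [Finset.sum_sub_distrib, Finset.sum_add_distrib, Finset.sum_const, Finset.card_univ,
    Fintype.card_fin, nsmul_eq_mul]
  ring

/-! ### The Green one-form: divergence-free, and `-Δ ω_p = d^*δ_p` -/

/-- The divergence of one column `e ↦ Γ(f, e)` of the edge Green kernel:
`div Γ(f, ·)(x) = G₀(x_f - x + e_i) - G₀(x_f - x)`, `i` the direction of `f`, `G₀ = latticeGreen / 2`. -/
theorem div_edgeGreen (f : ZdEdge d) (x : Site d) :
    ∑ j : Fin d, (edgeGreen f (x - Pi.single j 1, j) - edgeGreen f (x, j)) =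
      latticeGreen (f.1 - x + Pi.single f.2 1) / 2 - latticeGreen (f.1 - x) / 2 := by
  simp only [edgeGreen_apply, Finset.sum_sub_distrib]
  rw [Finset.sum_ite_eq, Finset.sum_ite_eq]
  simp only [Finset.mem_univ, if_true, sub_sub_eq_add_sub, add_sub_right_comm]

/-- **`div ω_p = 0`**: the Green one-form of a plaquette is divergence-free (`d^*Γd^*δ_p = Γ d^*d^* δ_p = 0`;
concretely a four-term telescoping of `G₀` differences around `∂p`). -/
theorem div_greenForm (p : ZdPlaquette d) (x : Site d) :
    ∑ j : Fin d, ((∑ a : Fin 4, plaquetteBoundarySign a * edgeGreen (plaquetteBoundary p a) (x - Pi.single j 1, j))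
      - ∑ a : Fin 4, plaquetteBoundarySign a * edgeGreen (plaquetteBoundary p a) (x, j)) = 0 := by
  have h : ∀ j : Fin d,
      (∑ a : Fin 4, plaquetteBoundarySign a * edgeGreen (plaquetteBoundary p a) (x - Pi.single j 1, j))
        - ∑ a : Fin 4, plaquetteBoundarySign a * edgeGreen (plaquetteBoundary p a) (x, j) =
      ∑ a : Fin 4, plaquetteBoundarySign a *
        (edgeGreen (plaquetteBoundary p a) (x - Pi.single j 1, j) - edgeGreen (plaquetteBoundary p a) (x, j)) := by
    intro j
    rw [← Finset.sum_sub_distrib]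
    exact Finset.sum_congr rfl fun a _ => by ring
  simp_rw [h]
  rw [Finset.sum_comm]
  simp_rw [← Finset.mul_sum, div_edgeGreen]
  simp only [Fin.sum_univ_four, plaquetteBoundarySign, plaquetteBoundary, Matrix.cons_val_zero,
    Matrix.cons_val_one, Matrix.cons_val_two, Matrix.cons_val_three, Matrix.tail_cons,
    Matrix.head_cons, add_sub_right_comm p.1 _ x]
  ring

/-- Reflection covariance of the lattice Laplacian: `Δ (x ↦ H(c - x)) (y) = (Δ H)(c - y)`. -/
theorem latticeLaplacianZd_comp_sub (H : Site d → ℝ) (c y : Site d) :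
    latticeLaplacianZd (fun x => H (c - x)) y = latticeLaplacianZd H (c - y) := by
  simp only [latticeLaplacianZd]
  congr 1
  refine Finset.sum_congr rfl fun i _ => ?_
  rw [add_comm (H (c - y + Pi.single i 1)), sub_add_eq_sub_sub, sub_sub_eq_add_sub, add_sub_assoc]
  ring_nf

/-- **`-Δ Γ(f, ·)_k = δ_f`**: the `k`-component of a column of the edge Green kernel has `-Δ` equal to the
edge indicator (`d ≥ 3`; `-Δ G₀ = δ₀`, tree `latticeLaplacianZd_half_latticeGreen`). -/
theorem neg_laplacian_edgeGreen (hd : 3 ≤ d) (f : ZdEdge d) (y : Site d) (k : Fin d) :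
    -latticeLaplacianZd (fun x => edgeGreen f (x, k)) y = if (y, k) = f then 1 else 0 := by
  obtain ⟨xf, i⟩ := f
  by_cases hik : i = k
  · subst hik
    have hfun : (fun x => edgeGreen (xf, i) (x, i)) = fun x => (fun z => latticeGreen z / 2) (xf - x) := by
      funext x
      simp [edgeGreen_apply]
    rw [hfun, latticeLaplacianZd_comp_sub (fun z => latticeGreen z / 2) xf y,
      latticeLaplacianZd_half_latticeGreen d hd, neg_neg]
    by_cases hy : y = xf
    · subst hy; simp
    · rw [if_neg (fun h => hy (sub_eq_zero.1 h).symm), if_neg]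
      simpa [Prod.mk.injEq] using hy
  · have hfun : (fun x => edgeGreen (xf, i) (x, k)) = fun _ => (0 : ℝ) := by
      funext x
      simp [edgeGreen_apply, hik]
    rw [hfun, latticeLaplacianZd_const, neg_zero, if_neg]
    simp only [Prod.mk.injEq, not_and]
    exact fun _ h => hik h.symm

/-- The Laplacian of a finite sum of functions. -/
theorem latticeLaplacianZd_finset_sum {ι : Type*} (s : Finset ι) (H : ι → Site d → ℝ) (x : Site d) :
    latticeLaplacianZd (fun y => ∑ i ∈ s, H i y) x = ∑ i ∈ s, latticeLaplacianZd (H i) x := by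
  classical
  induction s using Finset.induction_on with
  | empty => simp [latticeLaplacianZd]
  | insert a s ha ih =>
    simp only [Finset.sum_insert ha]
    rw [← ih, ← latticeLaplacianZd_add]
    rfl

/-- **`-Δ (ω_p)_k (y) = (d^*δ_p)(y, k) = (dδ_{(y,k)})(p)`**: the componentwise Laplacian of the Green one-form
of `p` is the signed indicator of the boundary of `p` (`d ≥ 3`). -/
theorem neg_laplacian_greenForm (hd : 3 ≤ d) (p : ZdPlaquette d) (y : Site d) (k : Fin d) :
    -latticeLaplacianZd
        (fun x => ∑ a : Fin 4, plaquetteBoundarySign a * edgeGreen (plaquetteBoundary p a) (x, k)) y =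
      plaquetteCurl (fun e => if e = (y, k) then (1 : ℝ) else 0) p := by
  have hlin : latticeLaplacianZd
      (fun x => ∑ a : Fin 4, plaquetteBoundarySign a * edgeGreen (plaquetteBoundary p a) (x, k)) y =
      ∑ a : Fin 4, plaquetteBoundarySign a * latticeLaplacianZd (fun x => edgeGreen (plaquetteBoundary p a) (x, k)) y := by
    rw [latticeLaplacianZd_finset_sum Finset.univ
      (fun a x => plaquetteBoundarySign a * edgeGreen (plaquetteBoundary p a) (x, k)) y]
    exact Finset.sum_congr rfl fun a _ => latticeLaplacianZd_const_mul _ _ _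
  rw [hlin, ← Finset.sum_neg_distrib, plaquetteCurl]
  refine Finset.sum_congr rfl fun a _ => ?_
  rw [← mul_neg, neg_laplacian_edgeGreen hd]
  by_cases h : (y, k) = plaquetteBoundary p a
  · rw [if_pos h, if_pos h.symm]
  · rw [if_neg h, if_neg (Ne.symm h)]

/-! ### The reproducing identity -/

/-- **Reproducing identity, single edge** (`d ≥ 3`): for every plaquette `p`, edge `e` and finite set `T`
of plaquettes containing all plaquettes through `e`,
`∑_{q ∈ T} (dδ_e)(q) · Π(p, q) = (dδ_e)(p)`, `Π = curvatureTwoPoint = dΓd^*`.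
Proof: `Π(p, ·) = dω_p`, Hodge `⟨dδ_e, dω_p⟩ = -Δ(ω_p)_k(y) - [div ω_p(y+e_k) - div ω_p(y)]`, `div ω_p = 0`,
`-Δ ω_p = d^*δ_p`. -/
theorem sum_plaquetteCurl_single_mul_curvatureTwoPoint (hd : 3 ≤ d) (p : ZdPlaquette d) (e : ZdEdge d)
    (T : Finset (ZdPlaquette d)) (hT : ∀ q : ZdPlaquette d, e ∈ plaquetteEdges q → q ∈ T) :
    ∑ q ∈ T, plaquetteCurl (fun e' => if e' = e then (1 : ℝ) else 0) q * curvatureTwoPoint p q =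
      plaquetteCurl (fun e' => if e' = e then (1 : ℝ) else 0) p := by
  obtain ⟨y, k⟩ := e
  simp_rw [← plaquetteCurl_greenForm p]
  rw [hodge_pairing _ y k T hT]
  beta_reduce
  rw [div_greenForm, div_greenForm, sub_zero, sub_zero, neg_laplacian_greenForm hd]

/-- A plaquette through an edge of `S` touches `S`. -/
theorem mem_plaquettesTouching_of_mem {S : Finset (ZdEdge d)} {e : ZdEdge d} (he : e ∈ S)
    {q : ZdPlaquette d} (hq : e ∈ plaquetteEdges q) : q ∈ plaquettesTouching S :=
  mem_plaquettesTouching_iff.2 ⟨e, Finset.mem_inter.2 ⟨hq, he⟩⟩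

/-- **Reproducing identity** (`d ≥ 3`): for every FINITELY SUPPORTED `1`-form `A` (support in the finite edge
set `S`), every plaquette `p` and every finite set `T` of plaquettes containing `plaquettesTouching S`,
`∑_{q ∈ T} (dA)(q) · Π(p, q) = (dA)(p)`: the kernel `Π = dΓd^*` reproduces compactly supported exact
`2`-forms (it is the projection onto exact forms). -/
theorem sum_plaquetteCurl_mul_curvatureTwoPoint (hd : 3 ≤ d) (p : ZdPlaquette d) (A : ZdEdge d → ℝ)
    (S : Finset (ZdEdge d)) (hS : ∀ e, A e ≠ 0 → e ∈ S)
    (T : Finset (ZdPlaquette d)) (hT : plaquettesTouching S ⊆ T) :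
    ∑ q ∈ T, plaquetteCurl A q * curvatureTwoPoint p q = plaquetteCurl A p := by
  rw [sum_mul_plaquetteCurl_eq_sum_support (curvatureTwoPoint p) A S hS T,
    plaquetteCurl_eq_sum_of_support A S hS p]
  refine Finset.sum_congr rfl fun f hf => ?_
  rw [sum_plaquetteCurl_single_mul_curvatureTwoPoint hd p f T
    (fun q hq => hT (mem_plaquettesTouching_of_mem hf hq))]

end Summit.QuantumFields.YangMills.Theorems.SteinGapBootstrap.BlockGreen
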